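import Summits.RiemannHypothesis.RiemannHypothesis.Theorems.Splittings.ScrewSparseDetect
import Summits.RiemannHypothesis.RiemannHypothesis.Theorems.Splittings.ScrewWindowRiseB

set_option linter.dupNamespace false

/-! # GEN-10 JOINS (cell rh-split, seat (screw, bridge)): g9 S1 `ScrewGradedFloor.stub_omegaDepth` +
g9 S3 `ScrewSparseDetect.stub_denseHits` + g10 window-rise law `ScrewWindowRise.powerSparseDetect_of`
⟹ the registered rung `Theses.SparseScrew.PowerSparseDetect` and its relabellings, UNCONDITIONALLY
(no stub, no sorry; the by-name identification with the route decl is `StubCheckG10.lean`).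
HONEST LABEL: these are RH-EQUIVALENCES and RH-free detection theorems; nothing here bears on the
truth of RH. -/

namespace Summit.RiemannHypothesis.RiemannHypothesis.Theorems.Splittings.ScrewSparseRung

open Literature.NumberTheory.LFunctions

/-- **THE RUNG `PowerSparseDetect` (statement unfolded), PROVED**: for every `θ < 1`, `C`, and every
`(C, θ)`-dense `A ⊆ ℕ`, `Ψ(log a) ≥ 0 ∀ a ∈ A ⟹ RH`. S2 (`stub_riseBound`) is BYPASSED by the
zero-side ½-Hölder window law. -/
theorem powerSparseDetect : ∀ θ : ℝ, θ < 1 → ∀ C : ℝ, ∀ A : Set ℕ,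
    (∀ m : ℕ, 1 ≤ m → ∃ a ∈ A, m ≤ a ∧ (a : ℝ) ≤ m + C * (m : ℝ) ^ θ) →
    (∀ m ∈ A, 0 ≤ zetaScrew (Real.log m)) → _root_.RiemannHypothesis :=
  ScrewWindowRise.powerSparseDetect_of ScrewGradedFloor.stub_omegaDepth
    ScrewSparseDetect.stub_denseHits

/-- `SqrtSparseDetect` (the `θ = 1/2` rung, g9) as the special case. -/
theorem sqrtSparseDetect' : ∀ C : ℝ, ∀ A : Set ℕ,
    (∀ m : ℕ, 1 ≤ m → ∃ a ∈ A, m ≤ a ∧ (a : ℝ) ≤ m + C * (m : ℝ) ^ (1 / 2 : ℝ)) →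
    (∀ m ∈ A, 0 ≤ zetaScrew (Real.log m)) → _root_.RiemannHypothesis :=
  powerSparseDetect (1 / 2) (by norm_num)

/-- **RH ⟺ nonnegativity of `Ψ ∘ log` on ANY ONE power-dense integer set.** -/
theorem rh_iff_nonneg_on_dense {θ : ℝ} (hθ : θ < 1) (C : ℝ) (A : Set ℕ)
    (hA : ∀ m : ℕ, 1 ≤ m → ∃ a ∈ A, m ≤ a ∧ (a : ℝ) ≤ m + C * (m : ℝ) ^ θ) :
    _root_.RiemannHypothesis ↔ ∀ a ∈ A, 0 ≤ zetaScrew (Real.log a) :=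
  ⟨fun hRH _ _ ↦ ZetaScrewThm17.zetaScrew_nonneg_of_RH hRH _, powerSparseDetect θ hθ C A hA⟩

/-- **S4 ⟺ RH, now UNCONDITIONAL** (the line file's `sparseDiagonal_iff_rh` took the rung as a
hypothesis): "Ψ∘log ≥ 0 along SOME polynomially dense integer set" ⟺ RH. -/
theorem sparseDiagonal_iff_rh :
    (∃ θ : ℝ, θ < 1 ∧ ∃ C : ℝ, ∃ A : Set ℕ,
      (∀ m : ℕ, 1 ≤ m → ∃ a ∈ A, m ≤ a ∧ (a : ℝ) ≤ m + C * (m : ℝ) ^ θ) ∧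
      ∀ a ∈ A, 0 ≤ zetaScrew (Real.log a)) ↔ _root_.RiemannHypothesis := by
  constructor
  · rintro ⟨θ, hθ, C, A, hA, hpos⟩
    exact powerSparseDetect θ hθ C A hA hpos
  · intro hRH
    obtain ⟨θ, hθ, C, hC⟩ := ScrewWindowRise.primes_dense
    exact ⟨θ, hθ, C, {p : ℕ | p.Prime}, hC, fun _ _ ↦ ZetaScrewThm17.zetaScrew_nonneg_of_RH hRH _⟩

/-- **RH ⟺ Ψ is globally ½-Hölder on `[0, ∞)`** (`⟹`: the window law at grade 0;
`⟸`: ½-Hölder from `Ψ(0) = 0` gives the floor `Ψ(t) ≥ -B√t`, incompatible with the Ω-depth S1 of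
any off-line zero). -/
theorem rh_iff_sqrtHolder : _root_.RiemannHypothesis ↔
    ∃ B : ℝ, ∀ t₀ t : ℝ, 0 ≤ t₀ → t₀ ≤ t →
      |zetaScrew t - zetaScrew t₀| ≤ B * Real.sqrt (t - t₀) :=
  ScrewWindowRise.rh_iff_sqrtHolder_of ScrewGradedFloor.stub_omegaDepth

/-- **RH ⟺ `Ψ(log p) ≥ 0` for every PRIME `p`** (Suzuki's criterion Thm 1.7 sampled at the primes
only; `⟸` = the rung with `A` = primes, dense by Hoheisel). -/
theorem rh_iff_nonneg_at_primes :
    _root_.RiemannHypothesis ↔ ∀ p : ℕ, p.Prime → 0 ≤ zetaScrew (Real.log p) :=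
  ScrewWindowRise.rh_iff_nonneg_at_primes_of ScrewGradedFloor.stub_omegaDepth
    ScrewSparseDetect.stub_denseHits

/-- **RH ⟺ `Ψ((q+1) log k) ≥ 0` for every `k ≥ 1`**, each fixed `q : ℕ` (`q = 1`: g9's squares). -/
theorem rh_iff_nonneg_at_powers (q : ℕ) :
    _root_.RiemannHypothesis ↔ ∀ k : ℕ, 1 ≤ k → 0 ≤ zetaScrew (((q : ℝ) + 1) * Real.log k) :=
  ScrewWindowRise.rh_iff_nonneg_at_powers_of ScrewGradedFloor.stub_omegaDepth
    ScrewSparseDetect.stub_denseHits q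

/-- `q = 2`, the CUBES: this is, token for token, the statement PLANTED in g9's negative control
`NEGCTL_P3.lean` (`2 * Real.log k ↦ 3 * Real.log k` made g9's squares PROOF fail, rc 1 at the planted
line); the planted STATEMENT is nevertheless true, and is now a theorem — negative controls test proofs,
not truth. -/
theorem rh_iff_nonneg_at_cubes :
    Summit.RiemannHypothesis ↔ ∀ k : ℕ, 1 ≤ k → 0 ≤ zetaScrew (3 * Real.log k) := by
  have h := rh_iff_nonneg_at_powers 2
  norm_num at h
  exact h

end Summit.RiemannHypothesis.RiemannHypothesis.Theorems.Splittings.ScrewSparseRung
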